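import Mathlib
import Summits.NavierStokesRegularity.NavierStokesRegularity.Theorems.FilamentSkeletonRssAnalyticStripLiaSymbolDefs

/-!
# Crux idea `kelvin-blind-scale-newton` — first-lemma sketch
Crux `SkeletonJ1R` (stmt-NavierStokesRegularity-23610), route `FilamentSkeletonRss` (negative side, MODEL route).
Planner `cruxidea-…-23610-1` g9, 2026-09-01.  Statements only (no proofs required by the protocol); every `def` is a
`Prop`.  Nothing here bears on Navier–Stokes regularity; `SkeletonJ1R` stays OPEN.

* `ScaleNewtonMajorant` — the abstract engine: Newton–Kantorovich in a SCALE of seminormed spaces in which ONLY the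
  right inverse loses scale (`η n ↦ η (n+1)`), majorant form.  Pure functional analysis (provable as stated).
* `TwoRegimeBookkeeping` — the real-arithmetic lemma that feeds it: with the two-regime constant profile
  (`M₀` while the shrink `η₀/2^(n+2)` is `≥ δc`, `M₀ + M₁·(shrink)⁻²` below) and `h₀ = M₀² B₀ ε₀ ≤ 1/4`, a majorant
  sequence exists with total correction `≤ 2 M₀ ε₀`.
* `FrozenLowBandBlindness`, `KelvinZoneDamping` — the frozen-symbol form of "Kelvin-blindness of the scale": on the
  algebraic zone `kμ ≤ 1/4` the bending-weighted inverse of the exact static self-induction symbol `𝔖` damped by the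
  shrink factor `e^{-kδ}` costs only `(2+ε)/log(δ/μ)` (vs `2/log Γ^{1/2}` for local induction), and on the Kelvin zone
  `kμ ≥ 1/4` the damping `e^{-δ/(4μ)}` beats any power of `Γ` once `δ ≥ C μ log Γ`.
-/

set_option linter.unusedVariables false
set_option autoImplicit false
set_option linter.dupNamespace false

namespace Summit.NavierStokesRegularity.NavierStokesRegularity.Cruxes.SkeletonJ1R.KelvinBlindScaleNewton

open Filter Topology
open Summit.NavierStokesRegularity.NavierStokesRegularity.Theorems.AnalyticStripLiaSymbol (liaSym)

/-- FIRST LEMMA (abstract engine) · NEWTON–KANTOROVICH IN A SCALE WITH LOSS ONLY IN THE RIGHT INVERSE, majorant form.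
`pE η`, `pV η` are families of seminorms on ONE pair of vector spaces, increasing in the level `η` (larger level =
larger analyticity domain = stronger seminorm); the levels `η n` decrease and stay `≥ ηinf`.  `F : E → V` has a
linearisation `L x` with a second-order Taylor bound WITHOUT loss, and right inverses `R x` bounded `pV (η n) → pE (η (n+1))`
by `M n` on the ball of radius `r`.  If real majorants `t n` satisfy `t 0 ≥ ‖F x₀‖`, `B n (M n t n)² ≤ t (n+1)`,
`∑ M n t n ≤ r`, `t n → 0`, and the terminal level is complete with `F` closed there, then `F` has a zero (in the terminal
seminorm) within `r` of `x₀`.  The Newton iterates are `x (n+1) = x n - R (x n) (F (x n))`. -/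
def ScaleNewtonMajorant : Prop :=
  ∀ (E V : Type) [AddCommGroup E] [Module ℝ E] [AddCommGroup V] [Module ℝ V]
    (pE : ℝ → Seminorm ℝ E) (pV : ℝ → Seminorm ℝ V)
    (F : E → V) (L : E → E →ₗ[ℝ] V) (R : E → V →ₗ[ℝ] E) (x₀ : E)
    (η : ℕ → ℝ) (ηinf r : ℝ) (M B t : ℕ → ℝ),
    (∀ a b : ℝ, a ≤ b → ∀ y : E, pE a y ≤ pE b y) →
    (∀ a b : ℝ, a ≤ b → ∀ z : V, pV a z ≤ pV b z) →
    (∀ n, η (n + 1) ≤ η n) → (∀ n, ηinf ≤ η n) →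
    (∀ n, 0 ≤ M n ∧ 0 ≤ B n ∧ 0 ≤ t n) → 0 ≤ r →
    (∀ n (x : E) (f : V), pE (η n) (x - x₀) ≤ r →
        L x (R x f) = f ∧ pE (η (n + 1)) (R x f) ≤ M n * pV (η n) f) →
    (∀ n (x y : E), pE (η n) (x - x₀) ≤ r → pE (η (n + 1)) y ≤ r →
        pV (η (n + 1)) (F (x + y) - F x - L x y) ≤ B n * (pE (η (n + 1)) y) ^ 2) →
    pV (η 0) (F x₀) ≤ t 0 →
    (∀ n, B n * (M n * t n) ^ 2 ≤ t (n + 1)) →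
    Summable (fun n => M n * t n) → (∑' n, M n * t n) ≤ r →
    Tendsto t atTop (𝓝 0) →
    (∀ u : ℕ → E, Summable (fun n => pE ηinf (u (n + 1) - u n)) →
        ∃ x : E, Tendsto (fun n => pE ηinf (u n - x)) atTop (𝓝 0)) →
    (∀ (u : ℕ → E) (x : E), Tendsto (fun n => pE ηinf (u n - x)) atTop (𝓝 0) →
        Tendsto (fun n => pV ηinf (F (u n))) atTop (𝓝 0) → pV ηinf (F x) = 0) →
    ∃ x : E, pV ηinf (F x) = 0 ∧ pE ηinf (x - x₀) ≤ r

/-- TWO-REGIME BOOKKEEPING (real arithmetic feeding `ScaleNewtonMajorant`).  Levels `η n = η₀/2 + η₀/2^(n+1)`, shrinks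
`δ n = η₀/2^(n+2)`; inverse profile `M₀` while `δ n ≥ δc` (the Kelvin-blind regime, `n ≤ N`), `M₀ + M₁/δ n ^ 2` after;
Taylor constant `B₀` throughout.  If `h₀ := M₀² B₀ ε₀ ≤ 1/4` and the (super-exponentially cheap) regime-switch condition
holds, a majorant sequence with `t 0 = ε₀`, the quadratic recursion, total correction `≤ 2 M₀ ε₀` and `t n → 0` exists. -/
def TwoRegimeBookkeeping : Prop :=
  ∀ (η₀ δc M₀ M₁ B₀ ε₀ : ℝ) (N : ℕ), 0 < η₀ → 0 < δc → 0 < M₀ → 0 ≤ M₁ → 0 < B₀ → 0 ≤ ε₀ →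
    δc ≤ η₀ / 2 ^ (N + 2) → η₀ / 2 ^ (N + 3) < δc →
    M₀ ^ 2 * B₀ * ε₀ ≤ 1 / 4 →
    16 * B₀ * (M₀ + M₁ * (2 ^ (N + 3) / η₀) ^ 2) ^ 2 * ε₀ * (M₀ ^ 2 * B₀ * ε₀) ^ (2 ^ (N + 1) - 1)
      ≤ M₀ ^ 2 * B₀ * ε₀ →
    let Mprof : ℕ → ℝ := fun n => if δc ≤ η₀ / 2 ^ (n + 2) then M₀ else M₀ + M₁ * (2 ^ (n + 2) / η₀) ^ 2
    ∃ t : ℕ → ℝ, t 0 = ε₀ ∧ (∀ n, 0 ≤ t n) ∧ (∀ n, B₀ * (Mprof n * t n) ^ 2 ≤ t (n + 1)) ∧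
      Summable (fun n => Mprof n * t n) ∧ (∑' n, Mprof n * t n) ≤ 2 * M₀ * ε₀ ∧ Tendsto t atTop (𝓝 0)

/-- KELVIN-BLINDNESS, frozen-symbol form, ALGEBRAIC ZONE `x = kμ ∈ (0, 1/4]`: the bending-weighted inverse of the exact
static self-induction symbol `𝔖` (`liaSym`, VERBATIM the tree's), damped by the shrink factor `e^{-xD}` (`D = δ/μ`), costs
at most `(2+ε)/log D`: `x² e^{-xD} ≤ ((2+ε)/log D)·|𝔖(x)|` for `D ≥ D₀(ε)`.  (Local induction at `kμ ≍ Γ^{-1/2}` gives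
`x²/|𝔖| ≈ 2/log Γ^{1/2}`; so the scale-inverse at shrink `δ` is the LIA inverse up to the factor `log Γ^{1/2}/log(δ/μ)`.)
Provable from the landed `liaSym_asymp` and mid-band bounds. -/
def FrozenLowBandBlindness : Prop :=
  ∀ ε : ℝ, 0 < ε → ∃ D₀ : ℝ, 1 < D₀ ∧ ∀ D x : ℝ, D₀ ≤ D → 0 < x → x ≤ 1 / 4 →
    x ^ 2 * Real.exp (-(x * D)) ≤ (2 + ε) / Real.log D * |liaSym x|

/-- KELVIN-BLINDNESS, KELVIN ZONE `x = kμ ≥ 1/4`: once the shrink is `δ ≥ C μ log Γ`, the damping beats any power: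
`x² e^{-xD} ≤ Γ^{-p}` for `D ≥ C log Γ` (`C = C(p)`).  Elementary; recorded because it is the literal heart of the card:
polynomially lossy Kelvin-band inverses (`Γ^{O(1)}`) become invisible in the scale norm. -/
def KelvinZoneDamping : Prop :=
  ∀ p : ℝ, 0 < p → ∃ C : ℝ, 0 < C ∧ ∀ Γ D x : ℝ, 2 ≤ Γ → C * Real.log Γ ≤ D → 1 / 4 ≤ x →
    x ^ 2 * Real.exp (-(x * D)) ≤ Γ ^ (-p)

end Summit.NavierStokesRegularity.NavierStokesRegularity.Cruxes.SkeletonJ1R.KelvinBlindScaleNewton
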